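/-
Copyright (c) 2026 the pub-hodgecm-mathlib formalisation cell (harness21).  Prover seat hodgecm-mathlib-B-p04 (g53): P6b wave B row QB3 (2-I)
«CHART COACTION, SCHEME → RING», PART 2∕2 «the coaction of an action» (DEALS v8, interim dealer desk F0P6d-plan (g8) «P6d-D1» ∕ heir desk
F0P6b-plan (g14); LEAD F0P6-plan (g8) «M-152w» (1); box LA-ref2 (g7); consumer (2-II) A-p12 (g36) and the §Q junction `stub_L4B1uQ_of_organs`),
2026-09-03.
-/
import Literature.AlgebraicGeometry.GroupSchemes.AffineGroupSchemeCoactionOfMorphism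
import Literature.AlgebraicGeometry.GroupSchemes.GroupSchemeActionOfPoints
import Literature.AlgebraicGeometry.GroupSchemes.GroupSchemeActionProperFree
import Mathlib.AlgebraicGeometry.Morphisms.FiniteType
import HarnessLib

/-!
# The coaction `Γ(U) → Γ(U) ⊗_R Γ(G)` of an action of an affine group scheme `G` on an affine scheme `U`

Topic `AlgebraicGeometry/GroupSchemes`; namespace `Literature.AlgebraicGeometry.GroupSchemes.AffineGroupScheme` (= the namespace of ★ `Alg`,
`ptEquiv`, `Alg.comap`, ★ PART 1 `coactionOf`).  DEFINITIONS (`coaction`, `coactionInv`) + theorems; no instance, no notation, no named fact, no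
`sorry`.  Cell `pub/hodgecm-mathlib` (D-0151), P6b wave B, organ Q4 of the Q0 census `CENSUS-Q-junction.v1` (439a1fb80ba72eb2) = the SEAM between
the scheme-side currency of the §Q socket (`[GrpObj G] [ModObj G U]` in `SchemeOver R = Over (Spec R)`, ★ `ActionRestrict`, ★ `IsFreeAction`)
and the ring-side currency of ★ sheet (A) (`FiniteFlatGroupSchemeQuotientAffine{,Torsor}`: `ρ : C →ₐ[R] C ⊗[R] H` with `hcoassoc`, `hcounit`,
`hfree`, `[Algebra.FiniteType R C]`).  Lane `--supports stmt-HodgeConjecture-24832`; count-neutral.  HC_CM is proved only modulo the printed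
citations (2 remaining named inputs hLiu418 = `stmt-HodgeConjecture-24832`, h413 = `stmt-HodgeConjecture-24833`) until rung 0 closes; nothing here
bears on it.

THE PRINT.  [MumfordAV1970] §12 (p. 111: the action on an affine `X = Spec A` «is given by a homomorphism of rings», the coaction), [GortzWedhorn2020]
Def. 4.44 (p. 117: actions are actions on `T`-valued points), [MumfordFogartyKirwan1994] Ch. 0 §3 Def. 0.8 (iv) (pp. 9–10: FREE iff `Ψ = (σ, p₂)`
is a closed immersion).  For AFFINE `G`, `U` over `R` with `[GrpObj G] [ModObj G U]`, `C := Γ(U)`, `H := Γ(G)`: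

* §5 **`coaction G U : Γ(U) →ₐ[R] Γ(U) ⊗_R Γ(G)`** `:= coactionOf U G (swap ≫ γ)`; **(★ρ-pt) `lift_ptEquiv_comp_coaction`** (`(x ⊗ g) ∘ ρ` =
  the algebra map of the point `g • x`); **(★ρ) `lift_comap_comp_coaction`** (`ρ` IS the pull-back `γ^* : Γ(U) → Γ(G ×_R U)` read through
  `c ⊗ h ↦ pr_U^*(c) · pr_G^*(h)`); HEADS in ★ sheet (A)'s token shape (`FiniteFlatGroupSchemeQuotientAffine.lean` :339–344 with `C := Alg U`,
  `H := Alg G`, `ρ := coaction G U`): **`coaction_counit`**, **`coaction_coassoc [IsCommMonObj G]`**, **`surjective_productMap_coaction_iff :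
  hfree ↔ IsFreeAction G U`**, `surjective_productMap_coaction`; and `Alg.finiteType` (`[Algebra.FiniteType R C]` from `LocallyOfFiniteType U.hom`).
* §6 for a GENERAL `G`: **`coactionInv G U`** = the coaction of the right action `x · g := g⁻¹ • x`, with (★ρ⁻¹-pt) `lift_ptEquiv_comp_coactionInv`,
  `coactionInv_counit`, `coactionInv_coassoc` (NO commutativity), `surjective_productMap_coactionInv_iff`.

CONVENTION NOTE (the one honest delta of this organ).  Sheet (A)'s `hcoassoc`, `(ρ ⊗ id) ∘ ρ = (id ⊗ Δ) ∘ ρ` in `C ⊗ H`, is the coaction of a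
RIGHT action (`x·(g₁g₂) = (x·g₁)·g₂` on points); Mathlib's `ModObj.mul_smul` is a LEFT action (`(g₁g₂)•x = g₁•(g₂•x)`).  Read through (★ρ) the two
agree iff `G` is commutative — the case of the §Q junction (a finite flat subgroup scheme `Z` of an abelian scheme acting by translations;
`IsCommMonObj Z` is ★ `TorsorQuotientKernelOnPoints.isCommMonObj_of_mono`).  So `coaction_coassoc` carries `[IsCommMonObj G]` and nothing else
does; §6 serves a non-commutative `G` through `g ↦ g⁻¹` (same invariants, same freeness).

NOT HERE (other rows of DEALS v8): the `Spec` form of sheet (A) over `coaction` ((2-II), A-p12 (g36)); the `Z`-stable affine cover (QB2);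
`Module.Free ∕ Module.Finite R (Alg Z)` for finite flat `Z` over local `R` (row (9)); the gluing (rows (7)(8)).

## References
* [MumfordAV1970] D. Mumford, *Abelian Varieties* (1970), §12 «Quotients by finite group schemes», p. 111 and Thm. 1.
* [GortzWedhorn2020] U. Görtz, T. Wedhorn, *Algebraic Geometry I*, 2nd ed. (2020), (4.15) and Definition 4.44 (pp. 116–117).
* [MumfordFogartyKirwan1994] D. Mumford, J. Fogarty, F. Kirwan, *Geometric Invariant Theory*, 3rd ed. (1994), Ch. 0 §3, Def. 0.8 (pp. 9–10).

## Design notes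
* Both `coaction` (§5) and `coactionInv` (§6) are three-line instances of ★ PART 1 `coactionOf` (parametric in the morphism and in two point-wise
  laws, the style of ★ `modObjOfPointwise`); the point-wise laws come from ★ `lift_one_comp_smul` ∕ `mul_smul` ∕ Mathlib `Hom.commGroup`
  (`mul_comm`) ∕ `mul_inv_rev`; freeness is transported along the swaps and `ι × 𝟙` with `MorphismProperty.cancel_left/right_of_respectsIso`.
* Searches: `lean search` for `coaction|IsCommMonObj.*Mono` under `Literature/` (★ `isCommMonObj_of_mono` found twice — cited, not restated);
  Mathlib `CartesianMonoidalCategory.lift_braiding_hom ∕ lift_whiskerRight ∕ braiding_hom_fst ∕ braiding_hom_snd`, `Hom.inv_def`,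
  `GrpObj.inv_comp_inv`, `HasRingHomProperty.appTop`.  Nothing is restated.
-/

set_option autoImplicit false

-- Mathlib's `Over`/`Scheme` APIs are stated across semireducible wrappers (as in the ★ `GroupSchemes/*` files).
set_option backward.isDefEq.respectTransparency false

universe u

open CategoryTheory CategoryTheory.Limits AlgebraicGeometry MonoidalCategory CartesianMonoidalCategory TensorProduct

noncomputable section

namespace Literature.AlgebraicGeometry.GroupSchemes

namespace AffineGroupScheme

open scoped MonObj

open Literature.AlgebraicGeometry.Motives Literature.NumberTheory.DiophantineGeometry

variable {R : Type u} [CommRing R]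

/-! ## §5 The coaction of an action `[ModObj G U]` -/

section Action

variable (G U : SchemeOver R) [IsAffine G.left] [IsAffine U.left] [GrpObj G] [ModObj G U]

/-- **The coaction of the action of `G` on `U`**: `ρ := ρ_a` for `a := (x, g) ↦ g • x` (the action `γ[G, U] : G ×_R U → U` precomposed with the
swap `U ×_R G ≅ G ×_R U`). [cite: MumfordAV1970, §12 Thm. 1 (p. 111)] -/
def coaction : Alg U →ₐ[R] Alg U ⊗[R] Alg G := coactionOf U G ((β_ U G).hom ≫ γ[G, U])

/-- **(★ρ-pt) the coaction on points**: `(x ⊗ g) ∘ ρ` is the algebra map of the point `g • x`. [cite: GortzWedhorn2020, Definition 4.44, p. 117] -/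
theorem lift_ptEquiv_comp_coaction {T : Type u} [CommRing T] [Algebra R T] (x : specOver R T ⟶ U) (g : specOver R T ⟶ G) :
    (Algebra.TensorProduct.lift (ptEquiv U T x) (ptEquiv G T g) fun _ _ => .all _ _).comp (coaction G U) = ptEquiv U T (g • x) := by
  rw [coaction, lift_comp_coactionOf, Equiv.symm_apply_apply, Equiv.symm_apply_apply, ← Category.assoc, lift_braiding_hom,
    smul_eq_lift_comp]

/-- **(★ρ) the coaction on `Γ`**: read through the canonical `Γ(U) ⊗_R Γ(G) → Γ(G ×_R U)`, `c ⊗ h ↦ pr_U^*(c) · pr_G^*(h)`, the coaction IS the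
pull-back `γ^* : Γ(U) → Γ(G ×_R U)` along the action. [cite: MumfordAV1970, §12 Thm. 1 (p. 111)] -/
theorem lift_comap_comp_coaction :
    (Algebra.TensorProduct.lift (Alg.comap (snd G U)) (Alg.comap (fst G U)) fun _ _ => .all _ _).comp (coaction G U) =
      Alg.comap γ[G, U] := by
  haveI := isAffine_tensorObj_left' G U
  have h := lift_ptEquiv_comp_coaction G U (T := Alg (G ⊗ U)) ((isoSpecOver (G ⊗ U)).inv ≫ snd G U) ((isoSpecOver (G ⊗ U)).inv ≫ fst G U)
  rw [← comap_eq_ptEquiv, ← comap_eq_ptEquiv, ← comp_smul_points, ← comap_eq_ptEquiv] at h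
  rw [h, smul_eq_lift_comp, lift_fst_snd, Category.id_comp]


omit [IsAffine G.left] [IsAffine U.left] in
/-- Every `T`-valued pair `(x, g)` goes to `g • x` under `a := swap ≫ γ`. [cite: GortzWedhorn2020, Definition 4.44, p. 117] -/
theorem lift_comp_braiding_comp_smul {W : SchemeOver R} (x : W ⟶ U) (g : W ⟶ G) :
    lift x g ≫ (β_ U G).hom ≫ γ[G, U] = g • x := by
  rw [← Category.assoc, lift_braiding_hom, smul_eq_lift_comp]

/-- **Counit law for the coaction of an action** (`hcounit` of ★ sheet (A), token shape of
`FiniteFlatGroupSchemeQuotientAffine.finite_faithfullyFlat_invariants` with `C := Γ(U)`, `H := Γ(G)`): `(id ⊗ ε)(ρ c) = c ⊗ 1`, i.e. `1 • x = x`.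
[cite: MumfordAV1970, §12 Thm. 1 (p. 111)] -/
theorem coaction_counit (c : Alg U) :
    TensorProduct.rid R (Alg U) (TensorProduct.map LinearMap.id (Coalgebra.counit (R := R) (A := Alg G)) (coaction G U c)) = c :=
  coactionOf_counit U G _ (fun _ x => by rw [lift_comp_braiding_comp_smul, one_smul]) c

omit [IsAffine G.left] [IsAffine U.left] in
/-- For a COMMUTATIVE `G`, `(x, g) ↦ g • x` is a right action on points: `g₂ • (g₁ • x) = (g₁ g₂) • x`.
[cite: GortzWedhorn2020, Definition 4.44, p. 117] -/
theorem smul_smul_eq_mul_smul_of_isCommMonObj [IsCommMonObj G] {W : SchemeOver R} (x : W ⟶ U) (g₁ g₂ : W ⟶ G) :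
    g₂ • (g₁ • x) = (g₁ * g₂) • x := by
  rw [← mul_smul, mul_comm]

/-- **Coassociativity law for the coaction of an action of a COMMUTATIVE group scheme** (`hcoassoc` of ★ sheet (A), token shape of
`FiniteFlatGroupSchemeQuotientAffine.finite_faithfullyFlat_invariants` with `C := Γ(U)`, `H := Γ(G)`): `(id ⊗ Δ)(ρ c) = assoc ((ρ ⊗ id)(ρ c))`.
The sheet's shape is that of a RIGHT coaction; for Mathlib's LEFT action `γ` it holds when `G` is commutative (the case of a subgroup
scheme of a commutative group scheme acting by translations); for general `G` use `coactionInv` below. [cite: MumfordAV1970, §12 Thm. 1 (p. 111)] -/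
theorem coaction_coassoc [IsCommMonObj G] (c : Alg U) :
    TensorProduct.map LinearMap.id (Coalgebra.comul (R := R) (A := Alg G)) (coaction G U c) =
      TensorProduct.assoc R (Alg U) (Alg G) (Alg G) (TensorProduct.map (coaction G U).toLinearMap LinearMap.id (coaction G U c)) :=
  coactionOf_coassoc U G _ (fun _ x g₁ g₂ => by
    rw [lift_comp_braiding_comp_smul, lift_comp_braiding_comp_smul, lift_comp_braiding_comp_smul,
      smul_smul_eq_mul_smul_of_isCommMonObj]) c

omit [IsAffine G.left] [IsAffine U.left] in
/-- `(pr₁, swap ≫ γ) : U × G → U × U` is Mumford's `Ψ = (γ, pr₂) : G × U → U × U` up to the two swaps. [cite: MumfordFogartyKirwan1994, Ch. 0 §3, Def. 0.8 (pp. 9–10)] -/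
theorem lift_fst_braiding_smul_eq : lift (fst U G) ((β_ U G).hom ≫ γ[G, U]) = (β_ U G).hom ≫ shear G U ≫ (β_ U U).hom := by
  apply CartesianMonoidalCategory.hom_ext
  · rw [lift_fst, Category.assoc, Category.assoc, braiding_hom_fst, shear_snd, braiding_hom_snd]
  · rw [lift_snd, Category.assoc, Category.assoc, braiding_hom_snd, shear_fst]

/-- **Freeness (`hfree` of ★ sheet (A)) ⟺ the action is free** (Mumford's `Ψ = (γ, pr₂)` a closed immersion, ★ `IsFreeAction`): the Galois map
`Γ(U) ⊗ Γ(U) → Γ(U) ⊗ Γ(G)`, `c ⊗ c' ↦ (c ⊗ 1) · ρ(c')`, is onto iff `G` acts freely on `U`. [cite: MumfordFogartyKirwan1994, Ch. 0 §3, Def. 0.8 (iv) (pp. 9–10)] -/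
theorem surjective_productMap_coaction_iff :
    Function.Surjective (Algebra.TensorProduct.productMap
        (Algebra.TensorProduct.includeLeft : Alg U →ₐ[R] Alg U ⊗[R] Alg G) (coaction G U)) ↔ IsFreeAction G U := by
  rw [coaction, surjective_productMap_coactionOf_iff, lift_fst_braiding_smul_eq, isFreeAction_iff, Over.comp_left, Over.comp_left,
    MorphismProperty.cancel_left_of_respectsIso @IsClosedImmersion, MorphismProperty.cancel_right_of_respectsIso @IsClosedImmersion]

/-- **`hfree` from a free action.** [cite: MumfordFogartyKirwan1994, Ch. 0 §3, Def. 0.8 (iv) (pp. 9–10)] -/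
theorem surjective_productMap_coaction (h : IsFreeAction G U) :
    Function.Surjective (Algebra.TensorProduct.productMap
        (Algebra.TensorProduct.includeLeft : Alg U →ₐ[R] Alg U ⊗[R] Alg G) (coaction G U)) :=
  (surjective_productMap_coaction_iff G U).2 h


/-- **`Γ(U)` is an `R`-algebra of finite type** when `U → Spec R` is (locally) of finite type (Mathlib `HasRingHomProperty` of
`LocallyOfFiniteType`) — the `[Algebra.FiniteType R C]` budget of ★ sheet (A). [cite: MumfordAV1970, §12 Thm. 1 (p. 111)] -/
theorem Alg.finiteType [LocallyOfFiniteType U.hom] : Algebra.FiniteType R (Alg U) := by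
  have h1 : U.hom.appTop.hom.FiniteType := HasRingHomProperty.appTop (P := @LocallyOfFiniteType) U.hom inferInstance
  have h2 : (Scheme.ΓSpecIso (.of R)).inv.hom.FiniteType :=
    RingHom.FiniteType.of_surjective _ fun y ↦ ⟨(Scheme.ΓSpecIso (.of R)).hom.hom y, by
      rw [← CommRingCat.comp_apply, Iso.hom_inv_id, CommRingCat.id_apply]⟩
  exact h1.comp h2

end Action

/-! ## §6 General `G`: the right action `x · g := g⁻¹ • x` and its coaction -/

section ActionInv

variable (G U : SchemeOver R) [IsAffine G.left] [IsAffine U.left] [GrpObj G] [ModObj G U]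

/-- **The coaction of `x · g := g⁻¹ • x`** (a right action for ANY `G`): `ρ⁻ := ρ_a` for `a := swap ≫ (ι × 𝟙) ≫ γ`.
[cite: MumfordAV1970, §12 Thm. 1 (p. 111)] -/
def coactionInv : Alg U →ₐ[R] Alg U ⊗[R] Alg G := coactionOf U G ((β_ U G).hom ≫ (ι[G] ▷ U) ≫ γ[G, U])

omit [IsAffine G.left] [IsAffine U.left] in
/-- Every `T`-valued pair `(x, g)` goes to `g⁻¹ • x` under `a := swap ≫ (ι × 𝟙) ≫ γ`. [cite: GortzWedhorn2020, Definition 4.44, p. 117] -/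
theorem lift_comp_braiding_inv_smul {W : SchemeOver R} (x : W ⟶ U) (g : W ⟶ G) :
    lift x g ≫ (β_ U G).hom ≫ (ι[G] ▷ U) ≫ γ[G, U] = g⁻¹ • x := by
  rw [← Category.assoc, lift_braiding_hom, ← Category.assoc, lift_whiskerRight, ← Hom.inv_def, smul_eq_lift_comp]

/-- **(★ρ⁻¹-pt)**: `(x ⊗ g) ∘ ρ⁻` is the algebra map of the point `g⁻¹ • x`. [cite: GortzWedhorn2020, Definition 4.44, p. 117] -/
theorem lift_ptEquiv_comp_coactionInv {T : Type u} [CommRing T] [Algebra R T] (x : specOver R T ⟶ U) (g : specOver R T ⟶ G) :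
    (Algebra.TensorProduct.lift (ptEquiv U T x) (ptEquiv G T g) fun _ _ => .all _ _).comp (coactionInv G U) =
      ptEquiv U T (g⁻¹ • x) := by
  rw [coactionInv, lift_comp_coactionOf, Equiv.symm_apply_apply, Equiv.symm_apply_apply, lift_comp_braiding_inv_smul]

/-- Counit law for `ρ⁻` (`hcounit` shape): `1⁻¹ • x = x`. [cite: MumfordAV1970, §12 Thm. 1 (p. 111)] -/
theorem coactionInv_counit (c : Alg U) :
    TensorProduct.rid R (Alg U) (TensorProduct.map LinearMap.id (Coalgebra.counit (R := R) (A := Alg G)) (coactionInv G U c)) = c :=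
  coactionOf_counit U G _ (fun _ x => by rw [lift_comp_braiding_inv_smul, inv_one, one_smul]) c

/-- **Coassociativity law for `ρ⁻`, ANY `G`** (`hcoassoc` shape): `g₂⁻¹ • (g₁⁻¹ • x) = (g₁ g₂)⁻¹ • x`. [cite: MumfordAV1970, §12 Thm. 1 (p. 111)] -/
theorem coactionInv_coassoc (c : Alg U) :
    TensorProduct.map LinearMap.id (Coalgebra.comul (R := R) (A := Alg G)) (coactionInv G U c) =
      TensorProduct.assoc R (Alg U) (Alg G) (Alg G) (TensorProduct.map (coactionInv G U).toLinearMap LinearMap.id (coactionInv G U c)) :=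
  coactionOf_coassoc U G _ (fun _ x g₁ g₂ => by
    rw [lift_comp_braiding_inv_smul, lift_comp_braiding_inv_smul, lift_comp_braiding_inv_smul, ← mul_smul, mul_inv_rev]) c

omit [IsAffine G.left] [IsAffine U.left] in
/-- `(pr₁, swap ≫ (ι × 𝟙) ≫ γ) = swap ≫ (ι × 𝟙) ≫ Ψ ≫ swap`. [cite: MumfordFogartyKirwan1994, Ch. 0 §3, Def. 0.8 (pp. 9–10)] -/
theorem lift_fst_braiding_inv_smul_eq :
    lift (fst U G) ((β_ U G).hom ≫ (ι[G] ▷ U) ≫ γ[G, U]) = (β_ U G).hom ≫ (ι[G] ▷ U) ≫ shear G U ≫ (β_ U U).hom := by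
  apply CartesianMonoidalCategory.hom_ext
  · rw [lift_fst, Category.assoc, Category.assoc, Category.assoc, braiding_hom_fst, shear_snd, whiskerRight_snd, braiding_hom_snd]
  · rw [lift_snd, Category.assoc, Category.assoc, Category.assoc, braiding_hom_snd, shear_fst]

omit [IsAffine G.left] [IsAffine U.left] [ModObj G U] in
/-- `ι × 𝟙_U` is an isomorphism (an involution). [cite: GortzWedhorn2020, Definition 4.44, p. 117] -/
theorem isIso_inv_whiskerRight : IsIso (ι[G] ▷ U) :=
  ⟨ι[G] ▷ U, by rw [← comp_whiskerRight, GrpObj.inv_comp_inv, id_whiskerRight],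
    by rw [← comp_whiskerRight, GrpObj.inv_comp_inv, id_whiskerRight]⟩

/-- **Freeness for `ρ⁻` ⟺ the action is free.** [cite: MumfordFogartyKirwan1994, Ch. 0 §3, Def. 0.8 (iv) (pp. 9–10)] -/
theorem surjective_productMap_coactionInv_iff :
    Function.Surjective (Algebra.TensorProduct.productMap
        (Algebra.TensorProduct.includeLeft : Alg U →ₐ[R] Alg U ⊗[R] Alg G) (coactionInv G U)) ↔ IsFreeAction G U := by
  haveI := isIso_inv_whiskerRight G U
  rw [coactionInv, surjective_productMap_coactionOf_iff, lift_fst_braiding_inv_smul_eq, isFreeAction_iff, Over.comp_left, Over.comp_left,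
    Over.comp_left, MorphismProperty.cancel_left_of_respectsIso @IsClosedImmersion,
    MorphismProperty.cancel_left_of_respectsIso @IsClosedImmersion, MorphismProperty.cancel_right_of_respectsIso @IsClosedImmersion]

end ActionInv

end AffineGroupScheme

end Literature.AlgebraicGeometry.GroupSchemes

end
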